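import Literature.AlgebraicGeometry.Motives.StandardConjectureCFactorsOfProducts
import HarnessLib

/-!
# The standard conjectures `C` and `D` descend to dominated varieties
(Kleiman 1968 Prop. 1.2.4, §3; Kahn 2020 §3.5.1, Lemma 6.30 (2))

Let `W` be a Weil cohomology theory, `f : V ⟶ U` a morphism of smooth projective varieties of
dimensions `N = M + r` and `M`, and `ζ ∈ Aʳ(V)_ℚ` a rational algebraic class of the relative
dimension — classically, for `f` surjective, a multisection: a linear section of `V` by `r`
hyperplanes, generically finite over `U` of some degree `q > 0` (Kleiman 1968, proof of Prop. 1.2.4).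
By the projection formula (Kahn 2020 §3.5.1; this lane's `PushforwardProjectionFormula`)

  `f₊ (f* β ∪ ζ) = β ∪ f₊ ζ`, with `f₊ ζ ∈ A⁰(U)_ℚ = ℚ · 1`, say `f₊ ζ = q · 1`
  (`exists_pushforward_eq_ratCast_smul_one`, `pushforward_pullback_cup_eq_smul`),

so that when **`f₊ ζ ≠ 0`** — i.e. `tr_V (f* ω ∪ ζ) ≠ 0` for a generator `ω` of `H^{2M}(U)`
(`pushforward_eq_zero_iff`); we say `U` is *dominated* by `V` through `(f, ζ)` —

* `f*` is injective in every degree and `dim Hⁱ(U) ≤ dim Hⁱ(V)` (Kleiman 1968 Prop. 1.2.4;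
  `pullback_injective_of_pushforward_ne_zero`, `finrank_le_of_pushforward_ne_zero`);
* `h(U)` is a direct summand of `h(V)` through the algebraic correspondences `f*` and
  `q⁻¹ f₊ (· ∪ ζ)` (`exists_algebraic_retraction_pullback_of_pushforward_ne_zero`), hence
  **`πⁱ_V` algebraic ⇒ `πⁱ_U` algebraic and `C(V) ⇒ C(U)`** (Kahn 2020 Lemma 6.30 (2);
  `isAlgebraicOperator_id_of_pushforward_ne_zero`, `standardConjectureC_of_pushforward_ne_zero`);
* **`D(V) ⇒ D(U)`** (`standardConjectureD_of_pullback_injective`,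
  `standardConjectureD_of_pushforward_ne_zero`; Kleiman 1968 §3: `f* x` is numerically trivial
  when `x` is, by the adjunction and `pushforward_mem_ratAlgebraicClasses`, and `f*` is injective) —
  generalising the tree's `standardConjectureD_of_standardConjectureD_tensor` (`V = U × Z`);
* in particular **`C` holds, for every Weil cohomology theory, for every variety dominated in this
  sense by an abelian variety or by a product of two curves**
  (`standardConjectureC_of_dominant_abelianVariety`, `standardConjectureC_of_dominant_curves`).

The case `r = 0`, `ζ = 1` is `PushforwardProjectionFormula`'s `…_of_pullback_top_ne_zero` family.
Theorems only; no new definitions, no named facts.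

## References

* [Kleiman1968AlgebraicCycles] S. Kleiman, *Algebraic cycles and the Weil conjectures*, in: Dix
  exposés sur la cohomologie des schémas (1968), §1.2 Prop. 1.2.4, §1.3, §3.
* [Kahn2020] B. Kahn, *Zeta and L-functions of varieties and motives*, LMS Lecture Note Series 462
  (2020), §3.5.1 (projection formula), §6.9 Lemma 6.30 (2), Thm. 6.31 (1), (3).
-/

universe u v

open CategoryTheory AlgebraicGeometry MonoidalCategory CartesianMonoidalCategory

noncomputable section

namespace Literature.AlgebraicGeometry.Motives

namespace WeilCohomology

variable {k : Type u} [Field k] {K : Type v} [Field K] [CharZero K] (W : WeilCohomology k K)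
variable {N M r : ℕ} {V U : SchemeOver k}

/-! ## The degree of `f` on a relative class `ζ` -/

/-- **`f₊ ζ = q · 1` with `q ∈ ℚ`** for `ζ ∈ Aʳ(V)_ℚ`, `dim V = dim U + r`: `f₊ ζ ∈ A⁰(U)_ℚ`
(`pushforward_mem_ratAlgebraicClasses`) and `A⁰(U)_ℚ = ℚ · 1`
(`exists_eq_ratCast_smul_one_of_mem_ratAlgebraicClasses_zero`). Degrees: `2r + 2M = 2N`,
`0 + 2M = 2M`. [cite: Kleiman1968AlgebraicCycles, §1.2 Prop. 1.2.4 (proof)] [cite: Kahn2020, §3.5.1] -/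
theorem exists_pushforward_eq_ratCast_smul_one (hV : IsSmoothProjective N V)
    (hU : IsSmoothProjective M U) (f : V ⟶ U) {ζ : W.obj V (2 * r)}
    (hζ : ζ ∈ W.ratAlgebraicClasses V r) (he : 2 * r + 2 * M = 2 * N) (hd : 0 + 2 * M = 2 * M) :
    ∃ q : ℚ, W.pushforward (N := N) hU f he hd ζ = (q : K) • W.one U :=
  W.exists_eq_ratCast_smul_one_of_mem_ratAlgebraicClasses_zero hU
    (W.pushforward_mem_ratAlgebraicClasses hV hU f (a := r) (b := 0) he hd hζ)

/-- **`f₊ (f* β ∪ ζ) = q · β`** on every `Hⁱ(U)` when `f₊ ζ = q · 1` (projection formula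
`f₊ (f* β ∪ ζ) = β ∪ f₊ ζ`, Kahn 2020 §3.5.1). Degrees: `i + i' = 2M`, `i + 2r + i' = 2N`.
[cite: Kahn2020, §3.5.1 (projection formula)] -/
theorem pushforward_pullback_cup_eq_smul (hV : IsSmoothProjective N V) (hU : IsSmoothProjective M U)
    (f : V ⟶ U) {ζ : W.obj V (2 * r)} {he : 2 * r + 2 * M = 2 * N} {hd : 0 + 2 * M = 2 * M}
    {q : ℚ} (hq : W.pushforward (N := N) hU f he hd ζ = (q : K) • W.one U) {i i' : ℕ}
    (hi : i + i' = 2 * M) (he' : i + 2 * r + i' = 2 * N) (β : W.obj U i) :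
    W.pushforward (N := N) hU f he' hi (W.cup rfl (W.pullback f i β) ζ) = (q : K) • β := by
  rw [W.pushforward_pullback_cup hV hU f rfl he' hi he hd (Nat.add_zero i) β ζ, hq, map_smul,
    W.cup_one hU (Nat.add_zero i)]

/-- **`tr_V (f* ω ∪ ζ) = q · tr_U ω`** for `ω ∈ H^{2M}(U)` when `f₊ ζ = q · 1` (the adjunction
`tr_V (f* ω ∪ ζ) = tr_U (ω ∪ f₊ ζ)`, Kahn 2020 §3.5.1). [cite: Kahn2020, §3.5.1] -/
theorem trace_pullback_cup_eq_mul (hV : IsSmoothProjective N V) (hU : IsSmoothProjective M U)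
    (f : V ⟶ U) {ζ : W.obj V (2 * r)} {he : 2 * r + 2 * M = 2 * N} {hd : 0 + 2 * M = 2 * M}
    {q : ℚ} (hq : W.pushforward (N := N) hU f he hd ζ = (q : K) • W.one U)
    (he' : 2 * M + 2 * r = 2 * N) (ω : W.obj U (2 * M)) :
    W.trace V N (W.cup he' (W.pullback f (2 * M) ω) ζ) = (q : K) * W.trace U M ω := by
  rw [W.trace_pullback_cup_eq hV hU f he hd he' (Nat.add_zero _) ω ζ, hq, map_smul, map_smul,
    W.cup_one hU (Nat.add_zero _), smul_eq_mul]

/-- **`f₊ ζ = 0 ⇔ tr_V (f* ω ∪ ζ) = 0` for all `ω ∈ H^{2M}(U)`** (equivalently for one generator):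
`tr_V (f* ω ∪ ζ) = q · tr_U ω`, `tr_U` is onto and `1 ≠ 0`. [cite: Kahn2020, §3.5.1] -/
theorem pushforward_eq_zero_iff (hV : IsSmoothProjective N V) (hU : IsSmoothProjective M U)
    (f : V ⟶ U) {ζ : W.obj V (2 * r)} (hζ : ζ ∈ W.ratAlgebraicClasses V r)
    (he : 2 * r + 2 * M = 2 * N) (hd : 0 + 2 * M = 2 * M) (he' : 2 * M + 2 * r = 2 * N) :
    W.pushforward (N := N) hU f he hd ζ = 0 ↔
      ∀ ω : W.obj U (2 * M), W.trace V N (W.cup he' (W.pullback f (2 * M) ω) ζ) = 0 := by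
  obtain ⟨q, hq⟩ := W.exists_pushforward_eq_ratCast_smul_one hV hU f hζ he hd
  constructor
  · intro h ω
    have hq1 : (q : K) • W.one U = 0 := by rw [← hq]; exact h
    rw [W.trace_pullback_cup_eq_mul hV hU f hq he' ω,
      (smul_eq_zero.mp hq1).resolve_right (W.unit_ne_zero hU), zero_mul]
  · intro h
    obtain ⟨ω, hω⟩ := (W.bijective_trace hU).2 1
    have h1 := W.trace_pullback_cup_eq_mul hV hU f hq he' ω
    rw [h ω, hω, mul_one] at h1
    rw [hq, ← h1, zero_smul]

/-! ## `f*` is injective (Kleiman 1968 Prop. 1.2.4) -/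

/-- **`f*` is injective in every degree when `f₊ ζ ≠ 0`** for some `ζ ∈ Aʳ(V)_ℚ`
(Kleiman 1968 Prop. 1.2.4: `f : V → U` surjective ⇒ `f*` injective — there `ζ` is a linear
section of `V` generically finite over `U`): `f₊ (f* β ∪ ζ) = q · β` with `q ≠ 0`.
[cite: Kleiman1968AlgebraicCycles, §1.2 Prop. 1.2.4] -/
theorem pullback_injective_of_pushforward_ne_zero (hV : IsSmoothProjective N V)
    (hU : IsSmoothProjective M U) (f : V ⟶ U) {ζ : W.obj V (2 * r)}
    (hζ : ζ ∈ W.ratAlgebraicClasses V r) {he : 2 * r + 2 * M = 2 * N} {hd : 0 + 2 * M = 2 * M}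
    (hne : W.pushforward (N := N) hU f he hd ζ ≠ 0) (i : ℕ) :
    Function.Injective (W.pullback f i) := by
  obtain ⟨q, hq⟩ := W.exists_pushforward_eq_ratCast_smul_one hV hU f hζ he hd
  have hq0 : (q : K) ≠ 0 := fun h ↦ hne (by rw [hq, h, zero_smul])
  by_cases hi : i ≤ 2 * M
  · intro β β' h
    have h' := congrArg (fun x ↦ W.pushforward (N := N) hU f (e := i + 2 * r) (d := i)
      (d' := 2 * M - i) (by omega) (by omega) (W.cup rfl x ζ)) h
    simpa only [W.pushforward_pullback_cup_eq_smul hV hU f hq (by omega : i + (2 * M - i) = 2 * M),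
      smul_right_inj hq0] using h'
  · haveI := W.subsingleton_obj hU (i := i) (by omega)
    exact fun a b _ ↦ Subsingleton.elim a b

/-- **`dim Hⁱ(U) ≤ dim Hⁱ(V)` for `U` dominated by `V`** (`f₊ ζ ≠ 0`; `f*` injective,
Kleiman 1968 Prop. 1.2.4). [cite: Kleiman1968AlgebraicCycles, §1.2 Prop. 1.2.4] -/
theorem finrank_le_of_pushforward_ne_zero (hV : IsSmoothProjective N V)
    (hU : IsSmoothProjective M U) (f : V ⟶ U) {ζ : W.obj V (2 * r)}
    (hζ : ζ ∈ W.ratAlgebraicClasses V r) {he : 2 * r + 2 * M = 2 * N} {hd : 0 + 2 * M = 2 * M}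
    (hne : W.pushforward (N := N) hU f he hd ζ ≠ 0) (i : ℕ) :
    Module.finrank K (W.obj U i) ≤ Module.finrank K (W.obj V i) := by
  haveI := W.finite_obj hV i
  exact LinearMap.finrank_le_finrank_of_injective
    (W.pullback_injective_of_pushforward_ne_zero hV hU f hζ hne i)

/-! ## `h(U)` is a direct summand of `h(V)`; `C(V) ⇒ C(U)` -/

/-- **An algebraic left inverse of `f*`**: if `f₊ ζ = q · 1 ≠ 0` (`ζ ∈ Aʳ(V)_ℚ`), the
degree-preserving graded operator `B = q⁻¹ f₊ ∘ (· ∪ ζ) : H•(V) → H•(U)` is an algebraic graded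
correspondence (composite of `exists_isAlgebraicGradedOp_cup` and
`exists_isAlgebraicGradedOp_pushforward`, Kleiman 1968 §1.3) with `Bᵢ ∘ f* = id` on every `Hⁱ(U)`
(`pushforward_pullback_cup_eq_smul`): `h(U)` is a direct summand of `h(V)` in homological
correspondences. [cite: Kleiman1968AlgebraicCycles, §1.3] [cite: Kahn2020, §6.9 Lemma 6.30 (2)] -/
theorem exists_algebraic_retraction_pullback_of_pushforward_ne_zero (hV : IsSmoothProjective N V)
    (hU : IsSmoothProjective M U) (f : V ⟶ U) {ζ : W.obj V (2 * r)}
    (hζ : ζ ∈ W.ratAlgebraicClasses V r) {he : 2 * r + 2 * M = 2 * N} {hd : 0 + 2 * M = 2 * M}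
    (hne : W.pushforward (N := N) hU f he hd ζ ≠ 0) :
    ∃ B : W.GradedOp V U, W.IsAlgebraicGradedOp N M B ∧ (∀ i j : ℕ, i ≠ j → B i j = 0) ∧
      ∀ i : ℕ, B i i ∘ₗ W.pullback f i = LinearMap.id := by
  obtain ⟨q, hq⟩ := W.exists_pushforward_eq_ratCast_smul_one hV hU f hζ he hd
  have hq0 : (q : K) ≠ 0 := fun h ↦ hne (by rw [hq, h, zero_smul])
  obtain ⟨C, hC, hC0, hCalg⟩ := W.exists_isAlgebraicGradedOp_cup hV hζ
  obtain ⟨P, hPalg, hP, hP0⟩ := W.exists_isAlgebraicGradedOp_pushforward hV hU f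
  have hCs : ∀ i l : ℕ, l ≠ i + 2 * r → C i l = 0 := fun i l hl ↦ hC0 fun h ↦ hl h.symm
  refine ⟨((q⁻¹ : ℚ) : K) • P.comp C, (W.isAlgebraicGradedOp_comp_holds hV hV hU hPalg hCalg).ratCast_smul q⁻¹,
    fun i j hij ↦ ?_, fun i ↦ ?_⟩
  · rw [Pi.smul_apply, Pi.smul_apply, PreWeilCohomology.GradedOp.comp_apply_of_shift P C (2 * r) hCs i j,
      hP0 (i + 2 * r) j (fun h ↦ hij (by obtain ⟨h1, -⟩ := h; omega)), LinearMap.zero_comp, smul_zero]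
  · rw [Pi.smul_apply, Pi.smul_apply, PreWeilCohomology.GradedOp.comp_apply_of_shift P C (2 * r) hCs i i]
    by_cases hi : i ≤ 2 * M
    · rw [hP (i + 2 * r) i (2 * M - i) (by omega) (by omega), hC rfl, LinearMap.smul_comp]
      refine LinearMap.ext fun β ↦ ?_
      rw [LinearMap.smul_apply, LinearMap.comp_apply, LinearMap.comp_apply, LinearMap.flip_apply,
        W.pushforward_pullback_cup_eq_smul hV hU f hq (by omega : i + (2 * M - i) = 2 * M) _ β,
        smul_smul, Rat.cast_inv, inv_mul_cancel₀ hq0, one_smul, LinearMap.id_apply]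
    · haveI := W.subsingleton_obj hU (i := i) (by omega)
      exact LinearMap.ext fun β ↦ Subsingleton.elim _ _

/-- **`πⁱ_V` algebraic ⇒ `πⁱ_U` algebraic for `U` dominated by `V`** (`f₊ ζ ≠ 0` for some
`ζ ∈ Aʳ(V)_ℚ`): `h(U)` is a direct summand of `h(V)`
(`exists_algebraic_retraction_pullback_of_pushforward_ne_zero`) and Kahn's Lemma 6.30 (2) applies
(`isAlgebraicOperator_id_of_retract`). [cite: Kahn2020, §6.9 Lemma 6.30 (2)] -/
theorem isAlgebraicOperator_id_of_pushforward_ne_zero (hV : IsSmoothProjective N V)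
    (hU : IsSmoothProjective M U) (f : V ⟶ U) {ζ : W.obj V (2 * r)}
    (hζ : ζ ∈ W.ratAlgebraicClasses V r) {he : 2 * r + 2 * M = 2 * N} {hd : 0 + 2 * M = 2 * M}
    (hne : W.pushforward (N := N) hU f he hd ζ ≠ 0) {i : ℕ}
    (hi : W.IsAlgebraicOperator N N (LinearMap.id : W.obj V i →ₗ[K] W.obj V i)) :
    W.IsAlgebraicOperator M M (LinearMap.id : W.obj U i →ₗ[K] W.obj U i) := by
  obtain ⟨B, hBalg, hBd, hBA⟩ :=
    W.exists_algebraic_retraction_pullback_of_pushforward_ne_zero hV hU f hζ hne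
  refine W.isAlgebraicOperator_id_of_retract hU hV
    (A := fun a b ↦ PreWeilCohomology.GradedOp.ofLinearMap (W.pullback f a) a b) (B := B)
    (W.isAlgebraicGradedOp_degreewise_pullback hV hU f) hBalg
    (fun a b hab ↦ PreWeilCohomology.GradedOp.degreewise_apply_of_ne _ hab) hBd ?_ hi
  simpa only [PreWeilCohomology.GradedOp.ofLinearMap_apply_same] using hBA i

/-- **`C(V) ⇒ C(U)` for `U` dominated by `V`**: `f : V ⟶ U` with `f₊ ζ ≠ 0` for some
`ζ ∈ Aʳ(V)_ℚ`, `dim V = dim U + r` (Kahn 2020 Lemma 6.30 (2); e.g. `f` surjective with `ζ` a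
generically finite multisection, Kleiman 1968 Prop. 1.2.4). [cite: Kahn2020, §6.9 Lemma 6.30 (2)]
[cite: Kleiman1968AlgebraicCycles, §1.2 Prop. 1.2.4] -/
theorem standardConjectureC_of_pushforward_ne_zero (hV : IsSmoothProjective N V)
    (hU : IsSmoothProjective M U) (f : V ⟶ U) {ζ : W.obj V (2 * r)}
    (hζ : ζ ∈ W.ratAlgebraicClasses V r) {he : 2 * r + 2 * M = 2 * N} {hd : 0 + 2 * M = 2 * M}
    (hne : W.pushforward (N := N) hU f he hd ζ ≠ 0) (hC : W.StandardConjectureC N V) :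
    W.StandardConjectureC M U :=
  W.standardConjectureC_iff.mpr fun _ ↦
    W.isAlgebraicOperator_id_of_pushforward_ne_zero hV hU f hζ hne (W.standardConjectureC_iff.mp hC _)

/-! ## `D(V) ⇒ D(U)` -/

/-- **`D` descends along morphisms with injective pull-back** (Kleiman 1968 §3, the mechanism of
`D(X × Z) ⇒ D(X)`): for `f : V ⟶ U`, `dim V = dim U + r`, if `x ∈ Aᵖ(U)_ℚ` is numerically trivial
then so is `f* x` — `tr_V (f* x ∪ y) = tr_U (x ∪ f₊ y)` (`trace_pullback_cup_eq`) with `f₊ y`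
rational algebraic (`pushforward_mem_ratAlgebraicClasses`) — hence `f* x = 0` under `D(V)`, and
`x = 0` if `f*` is injective on `H²ᵖ(U)`. [cite: Kleiman1968AlgebraicCycles, §3] -/
theorem standardConjectureD_of_pullback_injective (hV : IsSmoothProjective N V)
    (hU : IsSmoothProjective M U) (f : V ⟶ U) (hr : M + r = N)
    (hinj : ∀ p : ℕ, Function.Injective (W.pullback f (2 * p)))
    (hD : W.StandardConjectureD N V) : W.StandardConjectureD M U := by
  intro p q hpq x hx hperp
  refine hinj p ?_
  rw [map_zero]
  refine hD p (q + r) (by omega) _ (W.pullback_ratAlgebraicClasses_le hV hU f p ⟨x, hx, rfl⟩)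
    fun y hy ↦ ?_
  have hmem := W.pushforward_mem_ratAlgebraicClasses hV hU f (a := q + r) (b := q) (d' := 2 * p)
    (by omega) (by omega) hy
  have h0 := hperp _ hmem
  rw [W.cupPairing_apply] at h0 ⊢
  rw [W.trace_pullback_cup_eq hV hU f (by omega : 2 * (q + r) + 2 * p = 2 * N)
    (by omega : 2 * q + 2 * p = 2 * M) _ (by omega) x y]
  exact h0

/-- **`D(V) ⇒ D(U)` for `U` dominated by `V`** (`f₊ ζ ≠ 0` for some `ζ ∈ Aʳ(V)_ℚ`, so `f*` is
injective; Kleiman 1968 §3). Generalises the tree's `standardConjectureD_of_standardConjectureD_tensor`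
(`V = U × Z`, `f = pr_U`, `ζ = pr_Z^* b`). [cite: Kleiman1968AlgebraicCycles, §3] -/
theorem standardConjectureD_of_pushforward_ne_zero (hV : IsSmoothProjective N V)
    (hU : IsSmoothProjective M U) (f : V ⟶ U) {ζ : W.obj V (2 * r)}
    (hζ : ζ ∈ W.ratAlgebraicClasses V r) {he : 2 * r + 2 * M = 2 * N} {hd : 0 + 2 * M = 2 * M}
    (hne : W.pushforward (N := N) hU f he hd ζ ≠ 0) (hD : W.StandardConjectureD N V) :
    W.StandardConjectureD M U :=
  W.standardConjectureD_of_pullback_injective hV hU f (r := r) (by omega)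
    (fun p ↦ W.pullback_injective_of_pushforward_ne_zero hV hU f hζ hne (2 * p)) hD

/-! ## Varieties dominated by abelian varieties or by products of curves satisfy `C` -/

/-- **`C(U)` for `U` dominated by an abelian variety**, for every Weil cohomology theory: if
`f : A ⟶ U` with `f₊ ζ ≠ 0` for some `ζ ∈ Aʳ(A)_ℚ` (`dim A = dim U + r`), then `C(U)` — from
`C(A)` (Lieberman–Kleiman, the tree's `standardConjectureC_abelianVariety`; Kahn 2020 Thm. 6.31 (3))
and `standardConjectureC_of_pushforward_ne_zero`. E.g. Kummer varieties, or any variety finitely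
dominated by an abelian variety. [cite: Kahn2020, §6.9 Thm. 6.31 (3) and Lemma 6.30 (2)] -/
theorem standardConjectureC_of_dominant_abelianVariety {g : ℕ} (A : AbelianVariety k)
    (hA : IsSmoothProjective g A.X) (hU : IsSmoothProjective M U) (f : A.X ⟶ U)
    {ζ : W.obj A.X (2 * r)} (hζ : ζ ∈ W.ratAlgebraicClasses A.X r) {he : 2 * r + 2 * M = 2 * g}
    {hd : 0 + 2 * M = 2 * M} (hne : W.pushforward (N := g) hU f he hd ζ ≠ 0) :
    W.StandardConjectureC M U :=
  W.standardConjectureC_of_pushforward_ne_zero hA hU f hζ hne (W.standardConjectureC_abelianVariety A hA)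

/-- **`C(U)` for `U` dominated by a product of two curves**, for every Weil cohomology theory
(`C(C₁ × C₂)`: the tree's `standardConjectureC_tensor_curves`, Kahn 2020 Thm. 6.31 (1) with
Lemma 6.30 (3)). [cite: Kahn2020, §6.9 Thm. 6.31 (1) and Lemma 6.30 (2)–(3)] -/
theorem standardConjectureC_of_dominant_curves {C₁ C₂ : SchemeOver k} (h₁ : IsSmoothProjective 1 C₁)
    (h₂ : IsSmoothProjective 1 C₂) (hU : IsSmoothProjective M U) (f : C₁ ⊗ C₂ ⟶ U)
    {ζ : W.obj (C₁ ⊗ C₂) (2 * r)} (hζ : ζ ∈ W.ratAlgebraicClasses (C₁ ⊗ C₂) r)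
    {he : 2 * r + 2 * M = 2 * (1 + 1)} {hd : 0 + 2 * M = 2 * M}
    (hne : W.pushforward (N := 1 + 1) hU f he hd ζ ≠ 0) : W.StandardConjectureC M U :=
  W.standardConjectureC_of_pushforward_ne_zero (IsSmoothProjective.tensor_holds h₁ h₂) hU f hζ hne
    (W.standardConjectureC_tensor_curves h₁ h₂)

end WeilCohomology

end Literature.AlgebraicGeometry.Motives

end
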